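import Mathlib

/-!
# Sparse integer polynomials with a verified evaluation map (reflection core)
(blind cell PercRepro2, mine-a g27)

`Poly := List (ℤ × List ℕ)` — a list of (coefficient, exponent vector) pairs; `Poly.eval ρ P` is its
value at `ρ : ℕ → R`.  `merge` (fuelled, sound for every fuel), `scale`, `mul`, `neg` are computable;
each comes with an evaluation lemma, so an identity between two explicit polynomial expressions is
decided by the kernel on the lists (`decide +kernel`) and transported to `R` by the lemmas.
-/

namespace Summit.Ventures.PercRepro2

namespace PolyRefl

/-- Value of the monomial with exponent vector `m` starting at variable index `i`. -/
def monoEval {R : Type*} [CommRing R] (ρ : ℕ → R) : ℕ → List ℕ → R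
  | _, [] => 1
  | i, e :: t => ρ i ^ e * monoEval ρ (i + 1) t

/-- Exponent-wise sum of two exponent vectors (the product of the monomials). -/
def monoMul : List ℕ → List ℕ → List ℕ
  | [], m => m
  | m, [] => m
  | a :: s, b :: t => (a + b) :: monoMul s t

/-- Lexicographic comparison of exponent vectors. -/
def monoCmp : List ℕ → List ℕ → Ordering
  | [], [] => .eq
  | [], _ :: _ => .lt
  | _ :: _, [] => .gt
  | a :: s, b :: t =>
    match compare a b with
    | .eq => monoCmp s t
    | o => o

/-- A sparse polynomial: a list of (coefficient, exponent vector). -/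
abbrev Poly := List (ℤ × List ℕ)

/-- Evaluation of a sparse polynomial. -/
def eval {R : Type*} [CommRing R] (ρ : ℕ → R) : Poly → R
  | [] => 0
  | (c, m) :: t => (c : R) * monoEval ρ 0 m + eval ρ t

/-- Fuelled merge of two monomial lists, combining equal exponent vectors. -/
def merge : ℕ → Poly → Poly → Poly
  | 0, p, q => p ++ q
  | _ + 1, [], q => q
  | _ + 1, p, [] => p
  | n + 1, (c₁, m₁) :: p, (c₂, m₂) :: q =>
    match monoCmp m₁ m₂ with
    | .lt => (c₁, m₁) :: merge n p ((c₂, m₂) :: q)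
    | .gt => (c₂, m₂) :: merge n ((c₁, m₁) :: p) q
    | .eq => if c₁ + c₂ = 0 then merge n p q else (c₁ + c₂, m₁) :: merge n p q

/-- Multiply every term by the monomial `c · m`. -/
def scale (c : ℤ) (m : List ℕ) : Poly → Poly
  | [] => []
  | (c', m') :: t => (c * c', monoMul m m') :: scale c m t

/-- Sum of two polynomials (a merge with enough fuel). -/
def add (p q : Poly) : Poly := merge (p.length + q.length) p q

/-- Product of two polynomials. -/
def mul : Poly → Poly → Poly
  | [], _ => []
  | (c, m) :: t, q => add (scale c m q) (mul t q)

/-- Negation. -/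
def neg (p : Poly) : Poly := scale (-1) [] p

/-- Difference. -/
def sub (p q : Poly) : Poly := add p (neg q)

section Lemmas

variable {R : Type*} [CommRing R] (ρ : ℕ → R)

/-- Evaluation of `monoMul`. -/
lemma monoEval_monoMul : ∀ (i : ℕ) (m m' : List ℕ),
    monoEval ρ i (monoMul m m') = monoEval ρ i m * monoEval ρ i m'
  | _, [], m' => by simp [monoMul, monoEval]
  | _, _ :: _, [] => by simp [monoMul, monoEval]
  | i, a :: s, b :: t => by
    simp only [monoMul, monoEval, pow_add, monoEval_monoMul (i + 1) s t]
    ring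

/-- Evaluation of a concatenation. -/
lemma eval_append : ∀ (p q : Poly), eval ρ (p ++ q) = eval ρ p + eval ρ q
  | [], q => by simp [eval]
  | (c, m) :: t, q => by
    simp only [List.cons_append, eval, eval_append t q]
    ring

/-- Evaluation of a merge, for every fuel. -/
lemma eval_merge : ∀ (n : ℕ) (p q : Poly), eval ρ (merge n p q) = eval ρ p + eval ρ q
  | 0, p, q => by simp [merge, eval_append]
  | n + 1, [], q => by simp [merge, eval]
  | n + 1, (c, m) :: p, [] => by simp [merge, eval]
  | n + 1, (c₁, m₁) :: p, (c₂, m₂) :: q => by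
    simp only [merge]
    rcases hc : monoCmp m₁ m₂ with _ | _ | _
    · simp only [eval, eval_merge n p ((c₂, m₂) :: q)]
      ring
    · have hm : m₁ = m₂ := by
        induction m₁ generalizing m₂ with
        | nil => cases m₂ with
          | nil => rfl
          | cons b t => simp [monoCmp] at hc
        | cons a s ih => cases m₂ with
          | nil => simp [monoCmp] at hc
          | cons b t =>
            simp only [monoCmp] at hc
            rcases h : compare a b with _ | _ | _ <;> simp only [h] at hc
            · exact absurd hc (by decide)
            · rw [compare_eq_iff_eq] at h
              rw [h, ih t hc]
            · exact absurd hc (by decide)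
      subst hm
      split_ifs with h0
      · simp only [eval, eval_merge n p q]
        have : ((c₁ : R) + c₂) = 0 := by
          have h := congrArg (fun z : ℤ => (z : R)) h0
          push_cast at h
          exact h
        linear_combination (-(monoEval ρ 0 m₁)) * this
      · simp only [eval, eval_merge n p q, Int.cast_add]
        ring
    · simp only [eval, eval_merge n ((c₁, m₁) :: p) q]
      ring

/-- Evaluation of `scale`. -/
lemma eval_scale (c : ℤ) (m : List ℕ) : ∀ p : Poly,
    eval ρ (scale c m p) = (c : R) * monoEval ρ 0 m * eval ρ p
  | [] => by simp [scale, eval]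
  | (c', m') :: t => by
    simp only [scale, eval, eval_scale c m t, monoEval_monoMul, Int.cast_mul]
    ring

/-- Evaluation of `add`. -/
lemma eval_add (p q : Poly) : eval ρ (add p q) = eval ρ p + eval ρ q := eval_merge ρ _ p q

/-- Evaluation of `mul`. -/
lemma eval_mul : ∀ (p q : Poly), eval ρ (mul p q) = eval ρ p * eval ρ q
  | [], q => by simp [mul, eval]
  | (c, m) :: t, q => by
    simp only [mul, eval, eval_add, eval_scale, eval_mul t q]
    ring

/-- Evaluation of `neg`. -/
lemma eval_neg (p : Poly) : eval ρ (neg p) = -eval ρ p := by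
  simp [neg, eval_scale, monoEval]

/-- Evaluation of `sub`. -/
lemma eval_sub (p q : Poly) : eval ρ (sub p q) = eval ρ p - eval ρ q := by
  simp [sub, eval_add, eval_neg, sub_eq_add_neg]

end Lemmas

section Order

variable {R : Type*} [CommRing R] [PartialOrder R] [IsOrderedRing R]

/-- A monomial at nonnegative arguments is nonnegative. -/
lemma monoEval_nonneg (ρ : ℕ → R) (hρ : ∀ i, 0 ≤ ρ i) : ∀ (i : ℕ) (m : List ℕ),
    0 ≤ monoEval ρ i m
  | _, [] => by simp [monoEval]
  | i, e :: t => by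
    simp only [monoEval]
    exact mul_nonneg (pow_nonneg (hρ i) e) (monoEval_nonneg ρ hρ (i + 1) t)

/-- A polynomial with nonnegative coefficients is nonnegative at nonnegative arguments. -/
lemma eval_nonneg (ρ : ℕ → R) (hρ : ∀ i, 0 ≤ ρ i) :
    ∀ p : Poly, (∀ t ∈ p, 0 ≤ t.1) → 0 ≤ eval ρ p
  | [], _ => by simp [eval]
  | (c, m) :: t, h => by
    simp only [eval]
    have hc : 0 ≤ c := h (c, m) (List.mem_cons_self ..)
    have ht : ∀ x ∈ t, 0 ≤ x.1 := fun x hx => h x (List.mem_cons_of_mem _ hx)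
    exact add_nonneg (mul_nonneg (Int.cast_nonneg hc) (monoEval_nonneg ρ hρ 0 m))
      (eval_nonneg ρ hρ t ht)

end Order

end PolyRefl

end Summit.Ventures.PercRepro2
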